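import Mathlib.LinearAlgebra.Matrix.GeneralLinearGroup.Defs
import Mathlib.RepresentationTheory.Basic
import Mathlib.RingTheory.MvPolynomial.Homogeneous
import Mathlib.Algebra.MvPolynomial.Eval
import Mathlib.Algebra.MvPolynomial.Rename
import Mathlib.LinearAlgebra.Matrix.Permutation
import HarnessLib

-- provenance: harness21/H21/H21/Prelude/CplxAlg/LinSubst.lean @ 12e2ffd (interim HEAD d8f2665); M5 mechanical rewrite
/-!
# Linear substitution action of `GL σ k` on polynomials

Trunk `CplxAlg` (algebraic complexity / geometric complexity theory), notion `gct_orbit_closure`,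
part 1 (outline C6 / D4).

A square matrix `A : Matrix σ σ k` acts on `MvPolynomial σ k` by the linear substitution of
variables `X i ↦ ∑ j, A j i • X j`, i.e. `(A · f)(x) = f(Aᵀ x)` when `f` is regarded as a function
of the column vector `x` of variables. This is a monoid homomorphism
`Matrix σ σ k →* (MvPolynomial σ k →ₐ[k] MvPolynomial σ k)`, and restricting to invertible matrices
gives a `Representation k (GL σ k) (MvPolynomial σ k)` in Mathlib's sense. Each homogeneous
component `homogeneousSubmodule σ k m` (the space of degree-`m` forms) is invariant, giving the
classical representation `formRep` of `GL σ k` on forms of degree `m`. We also define the orbit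
`glOrbit f = GL σ k · f` and the endomorphism orbit `endOrbit f = End(k^σ) · f`, whose Zariski
closures are the central objects of geometric complexity theory (file `OrbitClosure.lean`).

## Sources

* K. Mulmuley, M. Sohoni, *Geometric complexity theory I*, SIAM J. Comput. 31 (2001), §4.
* P. Bürgisser, C. Ikenmeyer, G. Panova, *No occurrence obstructions in geometric complexity
  theory*, J. AMS 32 (2019), §2.
* J. M. Landsberg, *Geometry and complexity theory*, CUP 2017, §1.2, §6.

## Mathlib

Mathlib has `MvPolynomial.aeval`, `Representation`, `Representation.subrepresentation`,
`MvPolynomial.homogeneousSubmodule`, `MvPolynomial.IsHomogeneous.aeval`, `Matrix.GeneralLinearGroup`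
and `Equiv.Perm.permMatrix`, all of which we use; it has no named action of matrices on
`MvPolynomial` by linear change of variables, which is what this file supplies.

## Design

* The convention `X i ↦ ∑ j, A j i • X j` (column `i` of `A`) makes `A ↦ linSubst A` a monoid
  homomorphism (covariant), proved sorry-free since it feeds the definition `linSubstRep`.
* `linSubstRep` is *defined* as the composite `GL σ k →* Matrix σ σ k →* (_ →ₐ[k] _) →* Module.End`,
  so `linSubstRep_apply` is `rfl`.
* The orbit as a *set* does not depend on whether one acts by `g` or `g⁻¹` (`glOrbit_eq_range_inv`).
-/

namespace Literature.Computability.AlgebraicComplexity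

open MvPolynomial

section LinSubstSec

variable (σ k : Type*) [Fintype σ] [CommRing k]

/-- The linear substitution of variables by a square matrix `A`: the `k`-algebra endomorphism of
`MvPolynomial σ k` sending `X i ↦ ∑ j, A j i • X j` (so `(A · f)(x) = f(Aᵀ x)` on coordinate
column vectors `x`).
Mulmuley–Sohoni 2001 §4; Landsberg 2017 §1.2. [cite: MulmuleySohoni2001, §4] -/
noncomputable def linSubst (A : Matrix σ σ k) : MvPolynomial σ k →ₐ[k] MvPolynomial σ k :=
  aeval fun i => ∑ j, A j i • X j

/-- `linSubst` on a variable: `X i ↦ ∑ j, A j i • X j`. Landsberg 2017 §1.2. [cite: Landsberg2017, §1.2] -/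
@[simp]
theorem linSubst_X (A : Matrix σ σ k) (i : σ) :
    linSubst σ k A (X i) = ∑ j, A j i • X j := by
  simp [linSubst]

/-- `linSubst` fixes constants (not `@[simp]`: `simp` proves it via `AlgHom` lemmas).
Landsberg 2017 §1.2. [cite: Landsberg2017, §1.2] -/
theorem linSubst_C (A : Matrix σ σ k) (c : k) : linSubst σ k A (C c) = C c := by
  simp [linSubst]

/-- The endomorphism orbit `End(k^σ) · f` of a polynomial: all linear substitutions, invertible or
not. For `k` an infinite field its Zariski closure equals the orbit closure (see
`OrbitClosure.lean`). Mulmuley–Sohoni 2001 §4; Landsberg 2017 §6. [cite: MulmuleySohoni2001, §4] -/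
def endOrbit (f : MvPolynomial σ k) : Set (MvPolynomial σ k) :=
  Set.range fun A : Matrix σ σ k => linSubst σ k A f

variable {σ k}

/-- Linear substitution preserves homogeneity of each degree. Landsberg 2017 §1.2. [cite: Landsberg2017, §1.2] -/
theorem linSubst_isHomogeneous (A : Matrix σ σ k) {f : MvPolynomial σ k} {m : ℕ}
    (hf : f.IsHomogeneous m) : (linSubst σ k A f).IsHomogeneous m := by
  have h1 : ∀ i, (∑ j, A j i • X j : MvPolynomial σ k).IsHomogeneous 1 := fun i =>
    (mem_homogeneousSubmodule 1 _).mp <| Submodule.sum_mem _ fun j _ =>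
      Submodule.smul_mem _ _ ((mem_homogeneousSubmodule 1 _).mpr (isHomogeneous_X k j))
  simpa [linSubst] using hf.aeval (fun i => ∑ j, A j i • X j) h1

/-- The space of forms of degree `m` is invariant under linear substitution.
Landsberg 2017 §1.2. [cite: Landsberg2017, §1.2] -/
theorem linSubst_mem_homogeneousSubmodule (A : Matrix σ σ k) {f : MvPolynomial σ k} {m : ℕ}
    (hf : f ∈ homogeneousSubmodule σ k m) :
    linSubst σ k A f ∈ homogeneousSubmodule σ k m :=
  (mem_homogeneousSubmodule m _).mpr (linSubst_isHomogeneous A ((mem_homogeneousSubmodule m _).mp hf))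

/-- Linear substitution does not raise the total degree. Landsberg 2017 §1.2. [cite: Landsberg2017, §1.2] -/
def totalDegree_linSubst_le : Prop :=
  ∀ (A : Matrix σ σ k) (f : MvPolynomial σ k),
    (linSubst σ k A f).totalDegree ≤ f.totalDegree

variable (σ k)

/-- `linSubst` is multiplicative: `(A * B) · f = A · (B · f)`. Landsberg 2017 §1.2. [cite: Landsberg2017, §1.2] -/
theorem linSubst_mul (A B : Matrix σ σ k) :
    linSubst σ k (A * B) = (linSubst σ k A).comp (linSubst σ k B) := by
  apply MvPolynomial.algHom_ext
  intro i
  simp only [linSubst, AlgHom.comp_apply, aeval_X, map_sum, map_smul, Matrix.mul_apply,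
    Finset.sum_smul, Finset.smul_sum, smul_smul]
  rw [Finset.sum_comm]
  simp only [mul_comm]

variable [DecidableEq σ]

/-- The identity matrix acts as the identity. Landsberg 2017 §1.2. [cite: Landsberg2017, §1.2] -/
theorem linSubst_one : linSubst σ k 1 = AlgHom.id k _ := by
  apply MvPolynomial.algHom_ext
  intro i
  simp [linSubst, Matrix.one_apply]

/-- The linear substitution action as a monoid homomorphism from all square matrices (the
endomorphism monoid of `k^σ`) to `k`-algebra endomorphisms of the polynomial ring.
Mulmuley–Sohoni 2001 §4. [cite: MulmuleySohoni2001, §4] -/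
noncomputable def linSubstMonoidHom :
    Matrix σ σ k →* (MvPolynomial σ k →ₐ[k] MvPolynomial σ k) where
  toFun := linSubst σ k
  map_one' := linSubst_one σ k
  map_mul' := linSubst_mul σ k

/-- `linSubstMonoidHom` is `linSubst` (unfolding lemma; Mulmuley–Sohoni 2001 §4). [cite: MulmuleySohoni2001, §4] -/
@[simp]
theorem linSubstMonoidHom_apply (A : Matrix σ σ k) : linSubstMonoidHom σ k A = linSubst σ k A :=
  rfl

/-- The representation of `GL σ k` on `MvPolynomial σ k` by linear substitution of variables,
`g · f = f ∘ gᵀ`. Defined as the composite `GL σ k →* Matrix σ σ k →* (_ →ₐ[k] _) →* Module.End k _`.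
Mulmuley–Sohoni 2001 §4; Bürgisser–Ikenmeyer–Panova 2019 §2. [cite: MulmuleySohoni2001, §4] -/
noncomputable def linSubstRep : Representation k (GL σ k) (MvPolynomial σ k) :=
  (AlgHom.toEnd.comp (linSubstMonoidHom σ k)).comp (Units.coeHom (Matrix σ σ k))

/-- `linSubstRep g f = linSubst ↑g f`, by `rfl` (unfolding lemma; Mulmuley–Sohoni 2001 §4). [cite: MulmuleySohoni2001, §4] -/
@[simp]
theorem linSubstRep_apply (g : GL σ k) (f : MvPolynomial σ k) :
    linSubstRep σ k g f = linSubst σ k (g : Matrix σ σ k) f :=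
  rfl

/-- The `GL σ k`-orbit `GL · f` of a polynomial under linear substitution.
Mulmuley–Sohoni 2001 §4. [cite: MulmuleySohoni2001, §4] -/
def glOrbit (f : MvPolynomial σ k) : Set (MvPolynomial σ k) :=
  Set.range fun g : GL σ k => linSubstRep σ k g f

/-- The representation of `GL σ k` on forms (homogeneous polynomials) of degree `m`, obtained by
restricting `linSubstRep` to the invariant submodule `homogeneousSubmodule σ k m`.
Mulmuley–Sohoni 2001 §4 (`V = Sym^m`); Landsberg 2017 §1.2. [cite: MulmuleySohoni2001, §4 ( V = Sym^m] -/
noncomputable def formRep (m : ℕ) : Representation k (GL σ k) ↥(homogeneousSubmodule σ k m) :=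
  (linSubstRep σ k).subrepresentation (homogeneousSubmodule σ k m) fun g _ hf =>
    linSubst_mem_homogeneousSubmodule (g : Matrix σ σ k) hf

variable {σ k}

/-- `f` lies in its own orbit. Mulmuley–Sohoni 2001 §4. [cite: MulmuleySohoni2001, §4] -/
theorem mem_glOrbit_self (f : MvPolynomial σ k) : f ∈ glOrbit σ k f :=
  ⟨1, by simp⟩

/-- The `GL`-orbit is contained in the endomorphism orbit. Mulmuley–Sohoni 2001 §4. [cite: MulmuleySohoni2001, §4] -/
theorem glOrbit_subset_endOrbit (f : MvPolynomial σ k) : glOrbit σ k f ⊆ endOrbit σ k f := by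
  rintro _ ⟨g, rfl⟩
  exact ⟨(g : Matrix σ σ k), rfl⟩

/-- Convention independence: the orbit is the same set whether `g` acts via `g` or via `g⁻¹`
(i.e. `f ↦ f ∘ gᵀ` versus `f ↦ f ∘ g⁻ᵀ`). Landsberg 2017 §1.2. [cite: Landsberg2017, §1.2] -/
theorem glOrbit_eq_range_inv (f : MvPolynomial σ k) :
    glOrbit σ k f = Set.range fun g : GL σ k => linSubst σ k ((g⁻¹ : GL σ k) : Matrix σ σ k) f := by
  ext p
  constructor
  · rintro ⟨g, rfl⟩
    exact ⟨g⁻¹, by simp⟩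
  · rintro ⟨g, rfl⟩
    exact ⟨g⁻¹, rfl⟩

/-- Permutation matrices act by renaming variables: with the convention
`X i ↦ ∑ j, P j i • X j` and `P.permMatrix j i = if P j = i then 1 else 0`, the variable `X i` goes to
`X (P⁻¹ i)`. Landsberg 2017 §1.2. [cite: Landsberg2017, §1.2] -/
theorem linSubst_permMatrix (P : Equiv.Perm σ) :
    linSubst σ k (P.permMatrix k) = rename P.symm := by
  apply MvPolynomial.algHom_ext
  intro i
  simp only [linSubst_X, rename_X, Equiv.Perm.permMatrix, PEquiv.toMatrix_apply,
    Equiv.toPEquiv_apply, Option.mem_def, Option.some.injEq, ite_smul, one_smul, zero_smul,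
    Equiv.apply_eq_iff_eq_symm_apply, Finset.sum_ite_eq', Finset.mem_univ, if_true]

/-- Orbits partition: if `p ∈ GL · f` then `GL · p = GL · f`. Mulmuley–Sohoni 2001 §4. [cite: MulmuleySohoni2001, §4] -/
theorem glOrbit_eq_of_mem {f p : MvPolynomial σ k} (h : p ∈ glOrbit σ k f) :
    glOrbit σ k p = glOrbit σ k f := by
  obtain ⟨g, rfl⟩ := h
  ext q
  constructor
  · rintro ⟨h, rfl⟩
    exact ⟨h * g, by simp [map_mul]⟩
  · rintro ⟨h, rfl⟩
    refine ⟨h * g⁻¹, ?_⟩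
    change linSubstRep σ k (h * g⁻¹) (linSubstRep σ k g f) = _
    rw [← Module.End.mul_apply, ← map_mul, inv_mul_cancel_right]

end LinSubstSec

end Literature.Computability.AlgebraicComplexity
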